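import Mathlib
import HarnessLib
import Literature.Geometry.Lorentzian.KerrSchild
import Literature.Geometry.Lorentzian.KerrWaveDecay
import Literature.Geometry.Lorentzian.KerrConvergence
import Literature.Geometry.Lorentzian.KerrConvergenceProofs
import Literature.Geometry.Lorentzian.BoostedKerrSchildDecay
import Literature.Geometry.Lorentzian.MultiCentreKerrSchild
import Literature.Geometry.Lorentzian.KerrSchildChartCovariance

/-!
# Route LogTimeThreeAnnuli · crux `DyadicCapture` · stub `kerrSchildRigidity`

Pure Kerr–Schild algebra and elementary analysis in the REST frame of the ingoing Kerr–Schild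
chart (`Literature/Geometry/Lorentzian/KerrSchild.lean`): `g_{M,a} = η + 2H ℓ ⊗ ℓ`,
`H = M r³/(r⁴ + a² z²)`, `ℓ = (1, (r x₁ + a x₂)/(r² + a²), (r x₂ − a x₁)/(r² + a²), x₃/r)`,
`r = Kerr.radius a` (Kerr–Schild 1965, §2; Visser arXiv:0706.0622, (32)–(35)). The theorem
`stub_kerrSchildRigidity` is the conjunction of three facts consumed by the window-freezing step of
the line `registered` of the crux `DyadicCapture`:

1. **Injectivity at a shell point.** At `y₀ = (t, 0, s, z)` with `s ≠ 0`, `z ≠ 0` the map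
   `(M, a) ↦ g_{M,a}(y₀)` is injective on `{M > 0}`: reading off the components
   `g(∂₀, ∂_ν) = η_{0ν} + 2H ℓ_ν` (`Kerr.bilin_basisVector`, `ℓ₀ = 1`) gives successively `H = H'`
   (`ν = 0`), `r = r'` (`ν = 3`, `z ≠ 0`), `a² = a'²` (`ν = 2`, `s ≠ 0`), `a = a'` (`ν = 1`) and
   finally `M = M'` (`H = M r³/(r⁴ + a² z²)`). Here `r_a(y₀) > 0` for every `a` because `z ≠ 0`
   (`kerrSchildRigidity_radius_pos`, from the quartic `Kerr.radius_quartic`).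
2. **Continuity in the parameters.** For `y₀` with `z ≠ 0`, `(M, a) ↦ g_{M,a}(y₀)` is continuous:
   `g_{M,a}(y₀) = η + (2H ℓ) ⊗ ℓ` (`Kerr.bilin_eq_fun`) with `H = M r³/(r⁴ + a² z²)` and `r`, `ℓ`
   jointly smooth in `(a, y)` wherever `r > 0` (`Kerr.contDiffAt_radius₂`,
   `Kerr.contDiffAt_nullCovector₂`, as in `Kerr.contDiffAt_ksPert₂`).
3. **Ring blow-up of `H`.** For `M > 0` and a ring point `y = (t, x₁, x₂, 0)`, `x₁² + x₂² = a²`,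
   every neighbourhood of `y` contains points `y' = y ± ε ∂₁` of the same time with `r(y') > 0`
   and `H(y') ≥ C`: on `{z = 0, ρ² > a²}` one has `r² = ρ² − a²` (`Kerr.radius_sq`) and `H = M/r`,
   while `r(y') → r(y) = 0` as `ε → 0` (continuity of `Kerr.radius`).

References: R. P. Kerr, A. Schild (1965), §2 (key `KerrSchild1965`); M. Visser, arXiv:0706.0622,
(32)–(35) (key `arXiv07060622`). Mathlib + tree lemmas only; no named facts.
-/

-- the `Summit.FinalStateConjecture.FinalStateConjecture.…` namespace repeats the summit = sub-problem segment (D-0017); deliberate.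
set_option linter.dupNamespace false

noncomputable section

namespace Summit.FinalStateConjecture.FinalStateConjecture.Theorems

open Literature.Geometry.Lorentzian
open scoped Topology Manifold ENNReal ContDiff
open Filter Set

/-! ### Positivity of the Kerr–Schild radius off the equatorial plane -/

/-- `r_a(x) > 0` for EVERY `a` as soon as `z = x₃ ≠ 0`: if `r = 0` the quartic
`r⁴ − (ρ² − a²) r² − a² z² = 0` forces `a z = 0`, so `a = 0`, but then `r = ‖x⃗‖ ≥ |z| > 0`
(Visser arXiv:0706.0622, (35)). [cite: arXiv07060622, (35)] -/
theorem kerrSchildRigidity_radius_pos (a : ℝ) {x : E4} (h3 : x 3 ≠ 0) : 0 < Kerr.radius a x := by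
  rcases (Kerr.radius_nonneg a x).eq_or_lt with h0 | h0
  · exfalso
    have hq := Kerr.radius_quartic a x
    rw [← h0] at hq
    have haz : a * x 3 = 0 := by
      have h' : (a * x 3) ^ 2 = 0 := by nlinarith [hq]
      exact pow_eq_zero_iff two_ne_zero |>.1 h'
    have ha : a = 0 := (mul_eq_zero.1 haz).resolve_right h3
    subst ha
    rw [Kerr.radius_zero_left] at h0
    have hs := E4.spatialNorm_sq x
    rw [← h0] at hs
    have hz : 0 < x 3 ^ 2 := by positivity
    nlinarith [sq_nonneg (x 1), sq_nonneg (x 2)]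
  · exact h0

/-! ### (i) Injectivity of `(M, a) ↦ g_{M,a}(y₀)` at a shell point -/

/-- The components `g(∂₀, ∂_ν)`, `ν = 0, 1, 2, 3`, of the Kerr–Schild metric:
`g(∂₀, ∂₀) = −1 + 2H`, `g(∂₀, ∂₁) = 2H (r x₁ + a x₂)/(r² + a²)`,
`g(∂₀, ∂₂) = 2H (r x₂ − a x₁)/(r² + a²)`, `g(∂₀, ∂₃) = 2H x₃/r` (Kerr–Schild 1965, §2;
Visser arXiv:0706.0622, (32)–(34); `Kerr.bilin_basisVector` with `ℓ₀ = 1`). [cite: KerrSchild1965, §2] -/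
theorem kerrSchildRigidity_components (M a : ℝ) (y : E4) :
    Kerr.bilin M a y (E4.basisVector 0) (E4.basisVector 0) = -1 + 2 * Kerr.scalarH M a y ∧
    Kerr.bilin M a y (E4.basisVector 0) (E4.basisVector 1) =
      2 * Kerr.scalarH M a y *
        ((Kerr.radius a y * y 1 + a * y 2) / (Kerr.radius a y ^ 2 + a ^ 2)) ∧
    Kerr.bilin M a y (E4.basisVector 0) (E4.basisVector 2) =
      2 * Kerr.scalarH M a y *
        ((Kerr.radius a y * y 2 - a * y 1) / (Kerr.radius a y ^ 2 + a ^ 2)) ∧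
    Kerr.bilin M a y (E4.basisVector 0) (E4.basisVector 3) =
      2 * Kerr.scalarH M a y * (y 3 / Kerr.radius a y) := by
  refine ⟨?_, ?_, ?_, ?_⟩ <;>
    simp [Kerr.bilin_basisVector, Kerr.etaComp, Kerr.nullCovectorFun]

/-- The real algebra of the rigidity step: with `H = M r³/(r⁴ + a² z²)`, `H' = M' r'³/(r'⁴ + a'² z²)`
(`M, r, r' > 0`, `x = 0`, `s, z ≠ 0`), the four equations
`−1 + 2H = −1 + 2H'`, `2H (r x + a s)/(r² + a²) = 2H' (r' x + a' s)/(r'² + a'²)`,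
`2H (r s − a x)/(r² + a²) = 2H' (r' s − a' x)/(r'² + a'²)`, `2H z/r = 2H' z/r'`
force `M = M'` and `a = a'` (elementary; the coordinate form of Kerr–Schild 1965, §2). [folklore] -/
theorem kerrSchildRigidity_algebra {M M' a a' r r' x s z : ℝ} (hM : 0 < M) (hr : 0 < r)
    (hr' : 0 < r') (hx : x = 0) (hs : s ≠ 0) (hz : z ≠ 0)
    (c0 : -1 + 2 * (M * r ^ 3 / (r ^ 4 + a ^ 2 * z ^ 2)) =
      -1 + 2 * (M' * r' ^ 3 / (r' ^ 4 + a' ^ 2 * z ^ 2)))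
    (c1 : 2 * (M * r ^ 3 / (r ^ 4 + a ^ 2 * z ^ 2)) * ((r * x + a * s) / (r ^ 2 + a ^ 2)) =
      2 * (M' * r' ^ 3 / (r' ^ 4 + a' ^ 2 * z ^ 2)) * ((r' * x + a' * s) / (r' ^ 2 + a' ^ 2)))
    (c2 : 2 * (M * r ^ 3 / (r ^ 4 + a ^ 2 * z ^ 2)) * ((r * s - a * x) / (r ^ 2 + a ^ 2)) =
      2 * (M' * r' ^ 3 / (r' ^ 4 + a' ^ 2 * z ^ 2)) * ((r' * s - a' * x) / (r' ^ 2 + a' ^ 2)))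
    (c3 : 2 * (M * r ^ 3 / (r ^ 4 + a ^ 2 * z ^ 2)) * (z / r) =
      2 * (M' * r' ^ 3 / (r' ^ 4 + a' ^ 2 * z ^ 2)) * (z / r')) :
    M = M' ∧ a = a' := by
  subst hx
  simp only [mul_zero, zero_add, sub_zero] at c1 c2
  set H := M * r ^ 3 / (r ^ 4 + a ^ 2 * z ^ 2) with hH_def
  set H' := M' * r' ^ 3 / (r' ^ 4 + a' ^ 2 * z ^ 2) with hH'_def
  have hHpos : 0 < H := by positivity
  have hHH : H' = H := by linarith
  rw [hHH] at c1 c2 c3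
  have h2H : (2 * H) ≠ 0 := by positivity
  -- `ν = 3`: `r = r'`
  have hrr : r' = r := by
    have h := mul_left_cancel₀ h2H c3
    rw [div_eq_div_iff hr.ne' hr'.ne'] at h
    exact mul_left_cancel₀ hz h
  rw [hrr] at c1 c2 hH'_def
  have hden : 0 < r ^ 2 + a ^ 2 := by positivity
  have hden' : 0 < r ^ 2 + a' ^ 2 := by positivity
  -- `ν = 2`: `a² = a'²`
  have haa2 : a' ^ 2 = a ^ 2 := by
    have h := mul_left_cancel₀ h2H c2
    rw [div_eq_div_iff hden.ne' hden'.ne'] at h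
    have h' := mul_left_cancel₀ (mul_ne_zero hr.ne' hs) h
    linarith
  rw [haa2] at c1 hH'_def
  -- `ν = 1`: `a = a'`
  have haa : a = a' := by
    have h := mul_left_cancel₀ h2H c1
    rw [div_eq_div_iff hden.ne' hden.ne'] at h
    have h' := mul_right_cancel₀ hden.ne' h
    exact mul_right_cancel₀ hs h'
  refine ⟨?_, haa⟩
  -- `H = H'`: `M = M'`
  have hD : 0 < r ^ 4 + a ^ 2 * z ^ 2 := by positivity
  have h := hHH
  rw [hH'_def, hH_def, div_eq_div_iff hD.ne' hD.ne'] at h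
  have h' := mul_right_cancel₀ hD.ne' h
  exact (mul_right_cancel₀ (pow_ne_zero 3 hr.ne') h').symm

/-- **Kerr–Schild rigidity at a shell point.** At `y₀ = (t, 0, s, z)` with `s ≠ 0`, `z ≠ 0` the
map `(M, a) ↦ g_{M,a}(y₀)` is injective on `{M > 0}` (Kerr–Schild 1965, §2: the components
`g(∂₀, ∂_ν) = η_{0ν} + 2H ℓ_ν` determine `H`, `r`, `a²`, `a` and `M` in turn). [cite: KerrSchild1965, §2] -/
theorem kerrSchildRigidity_injective (y₀ : E4) (h1 : y₀ 1 = 0) (h2 : y₀ 2 ≠ 0) (h3 : y₀ 3 ≠ 0)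
    (M a M' a' : ℝ) (hM : 0 < M) (_hM' : 0 < M') (h : Kerr.bilin M a y₀ = Kerr.bilin M' a' y₀) :
    M = M' ∧ a = a' := by
  obtain ⟨e0, e1, e2, e3⟩ := kerrSchildRigidity_components M a y₀
  obtain ⟨e0', e1', e2', e3'⟩ := kerrSchildRigidity_components M' a' y₀
  rw [h] at e0 e1 e2 e3
  exact kerrSchildRigidity_algebra hM (kerrSchildRigidity_radius_pos a h3)
    (kerrSchildRigidity_radius_pos a' h3) h1 h2 h3 (e0.symm.trans e0') (e1.symm.trans e1')
    (e2.symm.trans e2') (e3.symm.trans e3')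

/-! ### (ii) Continuity of `(M, a) ↦ g_{M,a}(y₀)` -/

/-- **Joint regularity in the parameters.** For `y₀` with `z ≠ 0` the map `(M, a) ↦ g_{M,a}(y₀)`
is `C⁰` (indeed `Cⁿ`) at every parameter: `g_{M,a}(y₀) = η + (2H ℓ) ⊗ ℓ` (`Kerr.bilin_eq_fun`)
with `H = M r³/(r⁴ + a² z²)` and `r = r_a(y₀)`, `ℓ = ℓ_a(y₀)` jointly smooth in `(a, y)` wherever
`r > 0` (`Kerr.contDiffAt_radius₂`, `Kerr.contDiffAt_nullCovector₂`), which holds for every `a`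
since `z ≠ 0`. Kerr–Schild 1965, §3; Visser arXiv:0706.0622, (32)–(35). [cite: KerrSchild1965, §3] -/
theorem kerrSchildRigidity_contDiffAt (y₀ : E4) (h3 : y₀ 3 ≠ 0) (p : ℝ × ℝ) :
    ContDiffAt ℝ 0 (fun q : ℝ × ℝ => Kerr.bilin q.1 q.2 y₀) p := by
  have hr0 : 0 < Kerr.radius p.2 y₀ := kerrSchildRigidity_radius_pos p.2 h3
  have hι : ContDiffAt ℝ 0 (fun q : ℝ × ℝ => (q.2, y₀)) p := contDiffAt_snd.prodMk contDiffAt_const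
  have hR := Kerr.contDiffAt_radius₂ (p := (p.2, y₀)) (n := 0) hr0
  have hL := Kerr.contDiffAt_nullCovector₂ (p := (p.2, y₀)) (n := 0) hr0
  have hr : ContDiffAt ℝ 0 (fun q : ℝ × ℝ => Kerr.radius q.2 y₀) p :=
    ContDiffAt.comp (g := fun q : ℝ × E4 => Kerr.radius q.1 q.2) (f := fun q : ℝ × ℝ => (q.2, y₀))
      p hR hι
  have hl : ContDiffAt ℝ 0 (fun q : ℝ × ℝ => Kerr.nullCovector q.2 y₀) p :=
    ContDiffAt.comp (g := fun q : ℝ × E4 => Kerr.nullCovector q.1 q.2)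
      (f := fun q : ℝ × ℝ => (q.2, y₀)) p hL hι
  have hH : ContDiffAt ℝ 0 (fun q : ℝ × ℝ => Kerr.scalarH q.1 q.2 y₀) p := by
    unfold Kerr.scalarH
    refine (contDiffAt_fst.mul (hr.pow 3)).div
      ((hr.pow 4).add ((contDiffAt_snd.pow 2).mul contDiffAt_const)) ?_
    positivity
  have hfun : (fun q : ℝ × ℝ => Kerr.bilin q.1 q.2 y₀) = fun q => Minkowski.bilin +
      E4.tmul ((2 * Kerr.scalarH q.1 q.2 y₀) • Kerr.nullCovector q.2 y₀)
        (Kerr.nullCovector q.2 y₀) := by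
    funext q
    rw [Kerr.bilin_eq_fun]
  rw [hfun]
  exact contDiffAt_const.add (((contDiffAt_const.mul hH).smul hl).smulRight hl)

/-- **Continuity in the parameters.** For `y₀` with `z ≠ 0` the map `(M, a) ↦ g_{M,a}(y₀)` is
continuous (it is `C⁰` at every parameter, `kerrSchildRigidity_contDiffAt`; Kerr–Schild 1965,
§3). [cite: KerrSchild1965, §3] -/
theorem kerrSchildRigidity_continuous (y₀ : E4) (h3 : y₀ 3 ≠ 0) :
    Continuous (fun p : ℝ × ℝ => Kerr.bilin p.1 p.2 y₀) :=
  (contDiff_iff_contDiffAt.2 (kerrSchildRigidity_contDiffAt y₀ h3)).continuous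

/-! ### (iii) Blow-up of `H` at the ring -/

/-- On the equatorial plane `{z = 0}` outside the disc, `ρ² ≥ a²`, the Kerr–Schild radius is
`r² = ρ² − a²` (Visser arXiv:0706.0622, (35): the inner root is `|ρ² − a²|`). [cite: arXiv07060622, (35)] -/
theorem kerrSchildRigidity_radius_sq_of_three_eq_zero (a : ℝ) {x : E4} (h3 : x 3 = 0)
    (hρ : a ^ 2 ≤ E4.spatialNorm x ^ 2) :
    Kerr.radius a x ^ 2 = E4.spatialNorm x ^ 2 - a ^ 2 := by
  rw [Kerr.radius_sq, h3]
  have h : (E4.spatialNorm x ^ 2 - a ^ 2) ^ 2 + 4 * a ^ 2 * (0 : ℝ) ^ 2 =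
      (E4.spatialNorm x ^ 2 - a ^ 2) ^ 2 := by ring
  rw [h, Real.sqrt_sq (sub_nonneg.2 hρ)]
  ring

/-- On the equatorial plane `{z = 0}`, wherever `r ≠ 0`, `H = M r³/r⁴ = M/r`
(Visser arXiv:0706.0622, (33)). [cite: arXiv07060622, (33)] -/
theorem kerrSchildRigidity_scalarH_of_three_eq_zero (M a : ℝ) {x : E4} (h3 : x 3 = 0)
    (hr : Kerr.radius a x ≠ 0) : Kerr.scalarH M a x = M / Kerr.radius a x := by
  unfold Kerr.scalarH
  rw [h3]
  field_simp
  ring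

/-- **Ring blow-up of `H`.** For `M > 0` and a ring point `y = (t, x₁, x₂, 0)`, `x₁² + x₂² = a²`,
every neighbourhood of `y` contains a point `y' = y ± ε ∂₁` with the same time coordinate,
`r(y') > 0` and `H(y') ≥ C`: there `r² = ρ'² − a² = 2ε|x₁| + ε² > 0`, `H = M/r`, and `r(y') → 0`
as `ε → 0` (Visser arXiv:0706.0622, (33)–(35): the ring singularity). [cite: arXiv07060622, (33)–(35)] -/
theorem kerrSchildRigidity_blowup (M a : ℝ) (hM : 0 < M) (y : E4) (h3 : y 3 = 0)
    (hya : y 1 ^ 2 + y 2 ^ 2 = a ^ 2) (C : ℝ) (U : Set E4) (hU : U ∈ 𝓝 y) :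
    ∃ y' ∈ U, y' 0 = y 0 ∧ 0 < Kerr.radius a y' ∧ C ≤ Kerr.scalarH M a y' := by
  -- a direction `s ∂₁`, `s = ±1`, pointing out of the disc: `s x₁ ≥ 0`
  obtain ⟨s, hs0, hsy⟩ : ∃ s : ℝ, s ≠ 0 ∧ 0 ≤ s * y 1 := by
    rcases le_or_gt 0 (y 1) with h | h
    · exact ⟨1, one_ne_zero, by rwa [one_mul]⟩
    · exact ⟨-1, by norm_num, by nlinarith⟩
  -- the curve `γ ε = y + ε s ∂₁`
  set γ : ℝ → E4 := fun ε => y + (ε * s) • E4.basisVector 1 with hγ_def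
  have hγ0 : ∀ ε, γ ε 0 = y 0 := fun ε => by simp [γ]
  have hγ1 : ∀ ε, γ ε 1 = y 1 + ε * s := fun ε => by simp [γ]
  have hγ2 : ∀ ε, γ ε 2 = y 2 := fun ε => by simp [γ]
  have hγ3 : ∀ ε, γ ε 3 = 0 := fun ε => by simp [γ, h3]
  have hγc : Continuous γ := by
    simp only [hγ_def]
    fun_prop
  have hγy : γ 0 = y := by simp [γ]
  have hρ : ∀ ε, E4.spatialNorm (γ ε) ^ 2 - a ^ 2 = 2 * ε * (s * y 1) + ε ^ 2 * s ^ 2 := by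
    intro ε
    rw [E4.spatialNorm_sq, hγ1, hγ2, hγ3, ← hya]
    ring
  -- `r(y) = 0`
  have hr0 : Kerr.radius a y = 0 := by
    have h := kerrSchildRigidity_radius_sq_of_three_eq_zero a h3
      (by rw [E4.spatialNorm_sq, h3, ← hya]; nlinarith)
    rw [E4.spatialNorm_sq, h3, ← hya] at h
    exact pow_eq_zero_iff two_ne_zero |>.1 (by linarith)
  -- along the curve, for `ε > 0`: `r > 0` and `H = M/r`
  have key : ∀ ε, 0 < ε → 0 < Kerr.radius a (γ ε) ∧
      Kerr.scalarH M a (γ ε) = M / Kerr.radius a (γ ε) := by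
    intro ε hε
    have hpos : 0 < E4.spatialNorm (γ ε) ^ 2 - a ^ 2 := by
      rw [hρ]
      have : 0 < ε ^ 2 * s ^ 2 := by positivity
      nlinarith
    have hr2 := kerrSchildRigidity_radius_sq_of_three_eq_zero a (hγ3 ε) (by linarith)
    have hrne : Kerr.radius a (γ ε) ≠ 0 := fun h => by
      rw [h] at hr2
      linarith
    exact ⟨lt_of_le_of_ne (Kerr.radius_nonneg a _) (Ne.symm hrne),
      kerrSchildRigidity_scalarH_of_three_eq_zero M a (hγ3 ε) hrne⟩
  -- limits as `ε → 0`
  have hγt : Tendsto γ (𝓝 0) (𝓝 y) := by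
    have h := hγc.tendsto 0
    rwa [hγy] at h
  have hrt : Tendsto (fun ε => Kerr.radius a (γ ε)) (𝓝 0) (𝓝 0) := by
    have h := ((Kerr.continuous_radius a).comp hγc).tendsto 0
    rwa [Function.comp_apply, hγy, hr0] at h
  set K := max C 1
  have hK0 : 0 < K := lt_max_of_lt_right one_pos
  have hMK : 0 < M / K := div_pos hM hK0
  have ev1 : ∀ᶠ ε in 𝓝 (0 : ℝ), γ ε ∈ U := hγt hU
  have ev2 : ∀ᶠ ε in 𝓝 (0 : ℝ), Kerr.radius a (γ ε) < M / K := hrt (Iio_mem_nhds hMK)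
  obtain ⟨ε, ⟨hεU, hεr⟩, hε0⟩ := (((ev1.and ev2).filter_mono nhdsWithin_le_nhds).and
    (eventually_mem_nhdsWithin (a := (0 : ℝ)) (s := Ioi 0))).exists
  obtain ⟨hrpos, hH⟩ := key ε hε0
  refine ⟨γ ε, hεU, hγ0 ε, hrpos, ?_⟩
  rw [hH, le_div_iff₀ hrpos]
  calc C * Kerr.radius a (γ ε) ≤ K * Kerr.radius a (γ ε) :=
        mul_le_mul_of_nonneg_right (le_max_left _ _) hrpos.le
    _ ≤ K * (M / K) := mul_le_mul_of_nonneg_left hεr.le hK0.le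
    _ = M := mul_div_cancel₀ M hK0.ne'

/-! ### The registered stub -/

/-- **Stub `kerrSchildRigidity` of the line `registered` (crux `DyadicCapture`).** Pure Kerr–Schild
algebra of `g_{M,a} = η + 2H ℓ ⊗ ℓ` in the rest frame: (i) at a shell point `y₀ = (t, 0, s, z)`,
`s ≠ 0`, `z ≠ 0`, the map `(M, a) ↦ g_{M,a}(y₀)` is injective on `{M > 0}`; (ii) it is continuous
whenever `z ≠ 0`; (iii) for `M > 0`, `H_{M,a}` is unbounded at fixed time near every ring point
`(t, x₁, x₂, 0)`, `x₁² + x₂² = a²`, at points with `r > 0` (Kerr–Schild 1965, §2;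
Visser arXiv:0706.0622, (32)–(35)). [cite: KerrSchild1965, §2] -/
theorem stub_kerrSchildRigidity :
    (∀ (y₀ : E4), y₀ 1 = 0 → y₀ 2 ≠ 0 → y₀ 3 ≠ 0 → ∀ (M a M' a' : ℝ), 0 < M → 0 < M' → Kerr.bilin M a y₀ = Kerr.bilin M' a' y₀ → M = M' ∧ a = a') ∧ (∀ (y₀ : E4), y₀ 3 ≠ 0 → Continuous (fun p : ℝ × ℝ => Kerr.bilin p.1 p.2 y₀)) ∧ (∀ (M a : ℝ), 0 < M → ∀ (y : E4), y 3 = 0 → y 1 ^ 2 + y 2 ^ 2 = a ^ 2 → ∀ (C : ℝ), ∀ U ∈ nhds y, ∃ y' ∈ U, y' 0 = y 0 ∧ 0 < Kerr.radius a y' ∧ C ≤ Kerr.scalarH M a y') :=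
  ⟨kerrSchildRigidity_injective, kerrSchildRigidity_continuous,
    fun M a hM y h3 hya C U hU => kerrSchildRigidity_blowup M a hM y h3 hya C U hU⟩

end Summit.FinalStateConjecture.FinalStateConjecture.Theorems

end
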